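import Mathlib
import HarnessLib
import Summits.ValiantsHypothesis.ValiantsHypothesis.Theses.MonotoneRestoration
import Literature.Computability.AlgebraicComplexity.DiPatternExpressions
import Literature.Computability.AlgebraicComplexity.ValiantClasses
import Literature.Computability.AlgebraicComplexity.ValiantClassesProofs
import Literature.Computability.AlgebraicComplexity.QPBoundedClosure
import Literature.Computability.AlgebraicComplexity.GateQuotients
import Literature.Computability.AlgebraicComplexity.SymmetricCircuitLinCombSymmetry
import Summits.ValiantsHypothesis.ValiantsHypothesis.Theorems.MonotoneRestorationOrbitCompressionQPDiClosedOfInvariant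
import Summits.ValiantsHypothesis.ValiantsHypothesis.Theorems.MonotoneRestorationOrbitRestorationLinearVolumeQPHomogeneous

/-!
# Route MonotoneRestoration — aside `OrbitCompressionQP` (stmt-ValiantsHypothesis-18332):
# HOMOGENEOUS NORMAL FORM OF THE CRUX ITSELF — orbit-to-size compression reduces to homogeneous families

Helper file (`--supports stmt-ValiantsHypothesis-18332`), def-free.  `OrbitCompressionQP`: a matrix-symmetric
`VP` family over `ℂ` with square-symmetric circuits of quasi-polynomial ORBIT size has square-symmetric
circuits of quasi-polynomial SIZE.  This file proves that it suffices to establish this for HOMOGENEOUS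
families (`f_n` homogeneous of some degree `d_n` for every `n`), in the crux's own currency:

* `exists_diValue_eq_homogeneousComponent`, `exists_diClose_eq_homogeneousComponent` — LABEL-PRESERVING
  HOMOGENISATION of ONE-SORTED labelled pattern expressions (`DiPatternExpr`; edges degree `1`, constants
  degree `0`, sums/label-summations componentwise, products by the Cauchy formula
  `DepthReduction.homogeneousComponent_mul`);
* `homogeneousComponent_rename` — homogeneous components commute with every renaming of the variables (so
  matrix symmetry and square symmetry pass to components);
* `qpOrbit_homogeneousComponent` — ★ THE HYPOTHESIS CLASS IS CLOSED UNDER HOMOGENEOUS COMPONENTS: if `f`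
  has square-symmetric circuits of orbit size `≤ 2^((log₂ n + c)^c)`, so does `(f_n^{(d_n)})_n` for every
  degree selector `d` (one-sorted characterisation `OrbitSupport.qpOrbitFamily_iff_diNarrow_one` forward,
  homogenise the expression — same labels, same constant —, and back);
* `exists_symmetric_sum_range` — sums of `m` symmetrically computed polynomials on `≤ t` gates each are
  symmetrically computed on `≤ m (t + 8)` gates (iterated `IsSymmetric.exists_linComb`);
* ★ `orbitCompressionQP_iff_homogeneous` — **`OrbitCompressionQP` ⟺ `OrbitCompressionQP` on homogeneous
  families.**  Backward direction by the HARDEST-COMPONENT SELECTION: `ν(n,d)` = least size of a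
  square-symmetric circuit for `f_n^{(d)}` (one exists: apply the homogeneous crux to the component family
  with the constant selector `d`); `h_n := f_n^{(d*_n)}` with `d*_n` maximising `ν(n,·)` over `d ≤ deg f_n`
  is ONE homogeneous matrix-symmetric `VP` family with quasi-polynomial orbits
  (`OrbitRestorationLinearVolumeQPHomogeneous.isVPFamily_homogeneousComponent`, `qpOrbit_homogeneousComponent`),
  so the homogeneous crux bounds `ν(n, d*_n)`, hence every `ν(n,d)`, quasi-polynomially and UNIFORMLY in
  `d`; re-assemble `f_n = Σ_{d ≤ deg f_n} f_n^{(d)}` with `exists_symmetric_sum_range`.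

Honest label: a normal form for an open, banked aside (VH-free bookkeeping); no stub of line
`expression_compression` is closed; `OrbitCompressionQP`, the route and VP ≠ VNP are NOT moved.
References: Bürgisser–Clausen–Shokrollahi 1997, Lemma 21.25; Dawar–Wilsenach 2025 §3; Dawar–Pago–Seppelt
2025 §5, §7.
-/

noncomputable section

-- `Summit.ValiantsHypothesis.ValiantsHypothesis.…` is the tree's single-conjunct layout (Sub = Summit).
set_option linter.dupNamespace false

namespace Summit.ValiantsHypothesis.ValiantsHypothesis.Theorems.OrbitCompressionQPCruxHomogeneous

open Literature.Computability.AlgebraicComplexity MvPolynomial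
open Literature.Computability.AlgebraicComplexity.DiPatternExpr
open Summit.ValiantsHypothesis.ValiantsHypothesis.Theorems
open Summit.ValiantsHypothesis.ValiantsHypothesis.Theses.MonotoneRestoration

/-! ### Label-preserving homogenisation of one-sorted expressions -/

section Homogenisation

variable {k : ℕ}

/-- ★ **Homogenisation (one-sorted).**  For every one-sorted labelled pattern expression `e` with `k` labels
and every level `n` there is a sequence `h : ℕ → DiPatternExpr ℂ k` with
`value (h j) ℓ = (value e ℓ)^{(j)}` for all `j` and all assignments `ℓ`. [folklore] -/
theorem exists_diValue_eq_homogeneousComponent (n : ℕ) (e : DiPatternExpr ℂ k) :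
    ∃ h : ℕ → DiPatternExpr ℂ k, ∀ (j : ℕ) (ℓ : Fin k → Fin n),
      value n (h j) ℓ = homogeneousComponent j (value n e ℓ) := by
  induction e with
  | edge a b =>
    refine ⟨fun j => if j = 1 then edge a b else const 0, fun j ℓ => ?_⟩
    show value n (if j = 1 then edge a b else const 0) ℓ = homogeneousComponent j (value n (edge a b) ℓ)
    rw [value_edge, homogeneousComponent_of_mem
      ((mem_homogeneousSubmodule _ _).2 (isHomogeneous_X ℂ (ℓ a, ℓ b)))]
    by_cases hj : j = 1
    · subst hj; simp
    · rw [if_neg hj, if_neg hj, value_const, C_0]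
  | const c =>
    refine ⟨fun j => if j = 0 then const c else const 0, fun j ℓ => ?_⟩
    show value n (if j = 0 then const c else const 0) ℓ = homogeneousComponent j (value n (const c) ℓ)
    rw [value_const, homogeneousComponent_of_mem
      ((mem_homogeneousSubmodule _ _).2 (isHomogeneous_C (Fin n × Fin n) c))]
    by_cases hj : j = 0
    · subst hj; simp
    · rw [if_neg hj, if_neg hj, value_const, C_0]
  | add e₁ e₂ ih₁ ih₂ =>
    obtain ⟨h₁, hh₁⟩ := ih₁
    obtain ⟨h₂, hh₂⟩ := ih₂
    exact ⟨fun j => add (h₁ j) (h₂ j), fun j ℓ => by rw [value_add, hh₁, hh₂, value_add, map_add]⟩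
  | mul e₁ e₂ ih₁ ih₂ =>
    obtain ⟨h₁, hh₁⟩ := ih₁
    obtain ⟨h₂, hh₂⟩ := ih₂
    let P : ℕ → ℕ → DiPatternExpr ℂ k := fun j i =>
      Nat.rec (mul (h₁ 0) (h₂ j)) (fun t acc => add acc (mul (h₁ (t + 1)) (h₂ (j - (t + 1))))) i
    have hP : ∀ (j i : ℕ) (ℓ : Fin k → Fin n), value n (P j i) ℓ =
        ∑ t ∈ Finset.range (i + 1), homogeneousComponent t (value n e₁ ℓ) *
          homogeneousComponent (j - t) (value n e₂ ℓ) := by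
      intro j i ℓ
      induction i with
      | zero => simp [P, hh₁, hh₂]
      | succ i ih =>
        rw [Finset.sum_range_succ, ← ih]
        simp [P, hh₁, hh₂]
    refine ⟨fun j => P j j, fun j ℓ => ?_⟩
    rw [hP, value_mul, DepthReduction.homogeneousComponent_mul]
  | sumLabel a e ih =>
    obtain ⟨h, hh⟩ := ih
    exact ⟨fun j => sumLabel a (h j), fun j ℓ => by simp only [value_sumLabel, hh, map_sum]⟩

/-- Hence **the degree-`j` component of a closed one-sorted expression is a closed one-sorted expression with
the same labels**. [folklore] -/
theorem exists_diClose_eq_homogeneousComponent {n : ℕ} (e : DiPatternExpr ℂ k) (j : ℕ) :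
    ∃ e' : DiPatternExpr ℂ k, e'.close n = homogeneousComponent j (e.close n) := by
  obtain ⟨h, hh⟩ := exists_diValue_eq_homogeneousComponent n e
  refine ⟨h j, ?_⟩
  unfold DiPatternExpr.close
  simp only [map_sum, hh]

end Homogenisation

/-- **Homogeneous components commute with renaming** (any map of the variables: renaming preserves
homogeneity degree by degree). [folklore] -/
theorem homogeneousComponent_rename {σ τ : Type*} (φ : σ → τ) (d : ℕ) (p : MvPolynomial σ ℂ) :
    homogeneousComponent d (rename φ p) = rename φ (homogeneousComponent d p) := by
  have key : ∀ i : ℕ, homogeneousComponent d (rename φ (homogeneousComponent i p)) =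
      if d = i then rename φ (homogeneousComponent i p) else 0 :=
    fun i => homogeneousComponent_of_mem ((mem_homogeneousSubmodule _ _).2
      ((homogeneousComponent_isHomogeneous i p).rename_isHomogeneous))
  calc homogeneousComponent d (rename φ p)
      = homogeneousComponent d (rename φ
          (∑ i ∈ Finset.range (p.totalDegree + 1), homogeneousComponent i p)) := by
        rw [sum_homogeneousComponent]
    _ = ∑ i ∈ Finset.range (p.totalDegree + 1),
          homogeneousComponent d (rename φ (homogeneousComponent i p)) := by
        rw [map_sum, map_sum]
    _ = homogeneousComponent d (rename φ (homogeneousComponent d p)) := by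
        refine Finset.sum_eq_single d (fun i _ hi => ?_) (fun hd => ?_)
        · rw [key i, if_neg (Ne.symm hi)]
        · have hlt : p.totalDegree < d := by
            simpa [Finset.mem_range, Nat.lt_succ_iff] using hd
          rw [homogeneousComponent_eq_zero _ _ hlt, map_zero, map_zero]
    _ = rename φ (homogeneousComponent d p) := by rw [key d, if_pos rfl]

/-! ### The hypothesis class is closed under homogeneous components -/

/-- ★ **Quasi-polynomial orbits pass to homogeneous components.**  If `f_n` has square-symmetric circuits of
orbit size `≤ 2^((log₂ n + c)^c)` for every `n`, then so does the family `(f_n^{(d_n)})_n`, for every degree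
selector `d : ℕ → ℕ` (with one constant for all selectors' worth of levels: the one-sorted expressions are
homogenised label for label). [cite: DawarPagoSeppelt2025, Theorem 1.1 and §7 (p. 45)] -/
theorem qpOrbit_homogeneousComponent (f : (n : ℕ) → MvPolynomial (Fin n × Fin n) ℂ)
    (hf : ∃ c : ℕ, ∀ n : ℕ, ∃ (G : Type) (_ : Fintype G)
        (C : LabelledArithCircuit ℂ (Fin n × Fin n) Unit G),
      C.IsSymmetric (Equiv.Perm (Fin n)) ∧ C.eval (C.output ()) = f n ∧
        C.orbitSize (Equiv.Perm (Fin n)) ≤ 2 ^ ((Nat.log 2 n + c) ^ c))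
    (d : ℕ → ℕ) :
    ∃ c : ℕ, ∀ n : ℕ, ∃ (G : Type) (_ : Fintype G)
        (C : LabelledArithCircuit ℂ (Fin n × Fin n) Unit G),
      C.IsSymmetric (Equiv.Perm (Fin n)) ∧ C.eval (C.output ()) = homogeneousComponent (d n) (f n) ∧
        C.orbitSize (Equiv.Perm (Fin n)) ≤ 2 ^ ((Nat.log 2 n + c) ^ c) := by
  obtain ⟨h0, c, hc⟩ := (OrbitSupport.qpOrbitFamily_iff_diNarrow_one f).1 hf
  refine (OrbitSupport.qpOrbitFamily_iff_diNarrow_one _).2 ⟨fun σ => ?_, c, fun n hn => ?_⟩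
  · have h := h0 σ
    change rename (fun x : Fin 0 × Fin 0 => σ • x) (homogeneousComponent (d 0) (f 0)) =
      homogeneousComponent (d 0) (f 0)
    change rename (fun x : Fin 0 × Fin 0 => σ • x) (f 0) = f 0 at h
    rw [← homogeneousComponent_rename, h]
  · obtain ⟨k, e, hk, he⟩ := hc n hn
    obtain ⟨e', he'⟩ := exists_diClose_eq_homogeneousComponent (n := n) e (d n)
    exact ⟨k, e', hk, by rw [he', he]⟩

/-! ### Sums of symmetrically computed polynomials -/

/-- **Sums.**  If `g 0, …, g m` (here: `g i` for `i < m + 1`) are each computed by a `Γ`-symmetric circuit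
on `≤ t` gates, then `Σ_{i ≤ m} g i` is computed by a `Γ`-symmetric circuit on `≤ (m + 1) (t + 8)` gates
(iterated `IsSymmetric.exists_linComb` with coefficients `1, 1`). [folklore] -/
theorem exists_symmetric_sum_range {n : ℕ} (t : ℕ) :
    ∀ (m : ℕ) (g : ℕ → MvPolynomial (Fin n × Fin n) ℂ),
      (∀ i, i < m + 1 → ∃ (G : Type) (_ : Fintype G) (C : LabelledArithCircuit ℂ (Fin n × Fin n) Unit G),
        C.IsSymmetric (Equiv.Perm (Fin n)) ∧ C.eval (C.output ()) = g i ∧ Fintype.card G ≤ t) →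
      ∃ (G : Type) (_ : Fintype G) (C : LabelledArithCircuit ℂ (Fin n × Fin n) Unit G),
        C.IsSymmetric (Equiv.Perm (Fin n)) ∧ C.eval (C.output ()) = ∑ i ∈ Finset.range (m + 1), g i ∧
          Fintype.card G ≤ (m + 1) * (t + 8) := by
  intro m
  induction m with
  | zero =>
    intro g hg
    obtain ⟨G, hG, C, hC, hev, hcard⟩ := hg 0 (Nat.succ_pos 0)
    exact ⟨G, hG, C, hC, by rw [hev, Finset.sum_range_one], by omega⟩
  | succ m ih =>
    intro g hg
    obtain ⟨G₁, hG₁, C₁, hC₁, hev₁, hcard₁⟩ := ih g fun i hi => hg i (by omega)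
    obtain ⟨G₂, hG₂, C₂, hC₂, hev₂, hcard₂⟩ := hg (m + 1) (by omega)
    obtain ⟨G, hG, C, hC, hev, hcard⟩ := hC₁.exists_linComb C₁ C₂ hC₂ 1 1
    refine ⟨G, hG, C, hC, ?_, ?_⟩
    · rw [hev, hev₁, hev₂, map_one, one_mul, one_mul, Finset.sum_range_succ _ (m + 1)]
    · calc Fintype.card G ≤ Fintype.card G₁ + Fintype.card G₂ + 8 := hcard
        _ ≤ (m + 1) * (t + 8) + t + 8 := by omega
        _ = (m + 1 + 1) * (t + 8) := by ring

/-! ### The normal form -/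

/-- ★ **HOMOGENEOUS NORMAL FORM of the crux.**  `OrbitCompressionQP` holds if and only if it holds for
HOMOGENEOUS families: every matrix-symmetric `VP` family `f` with `f_n` homogeneous of some degree `d_n`
for every `n` that has square-symmetric circuits of quasi-polynomial orbit size has square-symmetric
circuits of quasi-polynomial size.  (Backward direction: hardest-component selection, see the file
header.) [cite: DawarWilsenach2025, Theorem 7.1 discussion; DawarPagoSeppelt2025, §5.6] -/
theorem orbitCompressionQP_iff_homogeneous :
    OrbitCompressionQP ↔
    ∀ f : (n : ℕ) → MvPolynomial (Fin n × Fin n) ℂ,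
      (∃ d : ℕ → ℕ, ∀ n, (f n).IsHomogeneous (d n)) →
      (∀ (n : ℕ) (σ τ : Equiv.Perm (Fin n)),
        MvPolynomial.rename (fun p : Fin n × Fin n => (σ p.1, τ p.2)) (f n) = f n) →
      IsVPFamily f →
      (∃ c : ℕ, ∀ n : ℕ, ∃ (G : Type) (_ : Fintype G)
          (C : LabelledArithCircuit ℂ (Fin n × Fin n) Unit G),
        C.IsSymmetric (Equiv.Perm (Fin n)) ∧ C.eval (C.output ()) = f n ∧
        C.orbitSize (Equiv.Perm (Fin n)) ≤ 2 ^ ((Nat.log 2 n + c) ^ c)) →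
      ∃ c : ℕ, ∀ n : ℕ, ∃ (G : Type) (_ : Fintype G)
          (C : LabelledArithCircuit ℂ (Fin n × Fin n) Unit G),
        C.IsSymmetric (Equiv.Perm (Fin n)) ∧ C.eval (C.output ()) = f n ∧
        Fintype.card G ≤ 2 ^ ((Nat.log 2 n + c) ^ c) := by
  constructor
  · exact fun H f _ hsymm hVP horb => H f hsymm hVP horb
  intro H f hsymm hVP horb
  classical
  -- the three hypotheses pass to every family of homogeneous components `n ↦ f_n^{(d n)}`
  have hsymm_comp : ∀ (d : ℕ → ℕ) (n : ℕ) (σ τ : Equiv.Perm (Fin n)),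
      rename (fun p : Fin n × Fin n => (σ p.1, τ p.2)) (homogeneousComponent (d n) (f n)) =
        homogeneousComponent (d n) (f n) := by
    intro d n σ τ
    rw [← homogeneousComponent_rename, hsymm]
  have hVP_comp : ∀ d : ℕ → ℕ, IsVPFamily fun n => homogeneousComponent (d n) (f n) :=
    OrbitRestorationLinearVolumeQPHomogeneous.isVPFamily_homogeneousComponent f hVP
  have horb_comp := qpOrbit_homogeneousComponent f horb
  -- a symmetric circuit for every component (apply the homogeneous crux to the constant selector)
  have hex : ∀ n d : ℕ, ∃ M : ℕ, ∃ (G : Type) (_ : Fintype G)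
      (C : LabelledArithCircuit ℂ (Fin n × Fin n) Unit G),
      C.IsSymmetric (Equiv.Perm (Fin n)) ∧ C.eval (C.output ()) = homogeneousComponent d (f n) ∧
        Fintype.card G ≤ M := by
    intro n d
    obtain ⟨c, hc⟩ := H (fun n => homogeneousComponent d (f n))
      ⟨fun _ => d, fun n => homogeneousComponent_isHomogeneous d (f n)⟩
      (hsymm_comp fun _ => d) (hVP_comp fun _ => d) (horb_comp fun _ => d)
    obtain ⟨G, hG, C, hC, hev, hcard⟩ := hc n
    exact ⟨_, G, hG, C, hC, hev, hcard⟩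
  -- the measure `ν n d`: least size of a square-symmetric circuit for `f_n^{(d)}`
  let ν : ℕ → ℕ → ℕ := fun n d => Nat.find (hex n d)
  have hν_spec : ∀ n d : ℕ, ∃ (G : Type) (_ : Fintype G)
      (C : LabelledArithCircuit ℂ (Fin n × Fin n) Unit G),
      C.IsSymmetric (Equiv.Perm (Fin n)) ∧ C.eval (C.output ()) = homogeneousComponent d (f n) ∧
        Fintype.card G ≤ ν n d :=
    fun n d => Nat.find_spec (hex n d)
  have hν_min : ∀ (n d M : ℕ), (∃ (G : Type) (_ : Fintype G)
      (C : LabelledArithCircuit ℂ (Fin n × Fin n) Unit G),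
      C.IsSymmetric (Equiv.Perm (Fin n)) ∧ C.eval (C.output ()) = homogeneousComponent d (f n) ∧
        Fintype.card G ≤ M) → ν n d ≤ M :=
    fun n d M hM => Nat.find_min' (hex n d) hM
  -- the hardest component per level
  have hmax : ∀ n : ℕ, ∃ d : ℕ, ∀ d' : ℕ, d' ≤ (f n).totalDegree → ν n d' ≤ ν n d := by
    intro n
    obtain ⟨d, -, hd⟩ := Finset.exists_max_image (Finset.range ((f n).totalDegree + 1)) (ν n)
      ⟨0, Finset.mem_range.2 (Nat.succ_pos _)⟩
    exact ⟨d, fun d' hd' => hd d' (Finset.mem_range.2 (Nat.lt_succ_of_le hd'))⟩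
  choose dstar hdstar using hmax
  obtain ⟨c₁, hc₁⟩ := H (fun n => homogeneousComponent (dstar n) (f n))
    ⟨dstar, fun n => homogeneousComponent_isHomogeneous (dstar n) (f n)⟩
    (hsymm_comp dstar) (hVP_comp dstar) (horb_comp dstar)
  -- every component is symmetrically computed in quasi-polynomial size, UNIFORMLY in the degree
  have hνQ : ∀ n d : ℕ, d ≤ (f n).totalDegree → ν n d ≤ 2 ^ ((Nat.log 2 n + c₁) ^ c₁) := by
    intro n d hd
    refine (hdstar n d hd).trans (hν_min n (dstar n) _ ?_)
    obtain ⟨G, hG, C, hC, hev, hcard⟩ := hc₁ n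
    exact ⟨G, hG, C, hC, hev, hcard⟩
  -- re-assembly `f_n = Σ_{d ≤ deg f_n} f_n^{(d)}`
  have hqp : IsQPBounded fun n => ((f n).totalDegree + 1) * (2 ^ ((Nat.log 2 n + c₁) ^ c₁) + 8) :=
    IsQPBounded.mul (IsPBounded.add_holds hVP.1.2 (IsPBounded.const 1)).isQPBounded
      (IsQPBounded.add ⟨c₁, fun n => le_rfl⟩ (IsQPBounded.const 8))
  obtain ⟨c₂, hc₂⟩ := hqp
  refine ⟨c₂, fun n => ?_⟩
  obtain ⟨G, hG, C, hC, hev, hcard⟩ := exists_symmetric_sum_range (2 ^ ((Nat.log 2 n + c₁) ^ c₁))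
    (f n).totalDegree (fun d => homogeneousComponent d (f n)) fun d hd => by
      obtain ⟨G, hG, C, hC, hev, hcard⟩ := hν_spec n d
      exact ⟨G, hG, C, hC, hev, hcard.trans (hνQ n d (by omega))⟩
  refine ⟨G, hG, C, hC, ?_, hcard.trans (hc₂ n)⟩
  rw [hev]
  exact sum_homogeneousComponent (f n)

end Summit.ValiantsHypothesis.ValiantsHypothesis.Theorems.OrbitCompressionQPCruxHomogeneous

end
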